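import Mathlib
import Summits.ValiantsHypothesis.ValiantsHypothesis.Theses.ValuativeGCT
import Literature.NumberTheory.DiophantineGeometry.SchurWeylPlethysmOrbitWeightsProofs
import Summits.ValiantsHypothesis.ValiantsHypothesis.Theorems.ValuativeGCTValuativeFlipGradedFloor
import Summits.ValiantsHypothesis.ValiantsHypothesis.Theorems.ValuativeGCTValuativeFlipHwvMul
import Summits.ValiantsHypothesis.ValiantsHypothesis.Theorems.ValuativeGCTValuativeFlipTruncMul

/-!
# The semigroup floor (per-side multiplicity lower-bound engine) and its det-side mirror
# (formal matching) — line `big-cell-semigroup-floor` for crux `ValuativeGCT.ValuativeFlip`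
(stmt-ValiantsHypothesis-12624; fourth line lead prover-line-stmt-ValiantsHypothesis-12624-a1-0, 2026-08-16;
skeleton `Cruxes/ValuativeFlip/Lines/big-cell-semigroup-floor.lean`).

Three sorry-free compositions of the line's landed stubs `stub_gradedFloor` (p96543), `stub_hwvMul`
(p96740) and `stub_truncMul` (p97060):

* `semigroupFloor` — the line's PER-SIDE ENGINE: in the coordinate ring `ℂ[Δ_m(f)]` of the orbit
  closure of ANY form `f` of degree `m ≠ 0`, `D + 1` algebraically independent highest-weight vectors
  of one weight `χ` force `orbitMultiplicity ℂ f m (k • χ) ≥ C(k + D, D)` for every `k` (a certified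
  polynomial lower bound on multiplicities along the ray `ℕ χ`, the first per-side multiplicity
  lower-bound mechanism in the tree beyond occurrence).
* `matching_floor` — the DET-SIDE MIRROR: `D + 1` algebraically independent elements of the crux's
  valuative truncation `T_U(Dg, t, ν)` (free degree, threshold, weight) force
  `dim T_U(k Dg, k t, k • ν) ≥ C(k + D, D)`.
* `census_forces_dependence` — FORMAL MATCHING (line card §3, "the kill"): a det census
  `dim T_U(k Dg, k t, k • ν) < C(k + D, D)` at any admissible centre forces every `D + 1` elements of
  `T_U(Dg, t, ν)` to be algebraically dependent in the polynomial ring `ℂ[End W]`.  Since `T_U`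
  contains the pull-backs `F(det_m(A·x))` of all highest-weight vectors `F` of weight `ν` of
  `ℂ[Sym^m ℂ^{m²}]` for every admissible `(U, r)` (the `ValuativeBound` mechanism, stmt-12625, proved),
  and the pull-back kills exactly `I(Δ(det_m))` (`OrbitMapKernel`, stmt-12627, proved), a census can
  only hold where the weight-`ν` ray algebra of `ℂ[Δ(det_m)]` has transcendence degree `≤ D` — a
  transcendence-degree flip against the `D + 1` independent seeds of `ℂ[Δ_m(X₀₀^{m-n} per_n)]`, which
  separates the two orbit closures by itself: the engine and the valuation are never load-bearing
  (`Cruxes/ValuativeFlip/Lines/big-cell-semigroup-floor.dead.md`).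

Sources: the line's cards; Kaveh–Khovanskii, Ann. Math. 176 (2012) §1 (semigroups of graded
algebras); BLMW, SIAM J. Comput. 40 (2011) §5.2; folklore.
-/

set_option linter.dupNamespace false

namespace Summit.ValiantsHypothesis.ValiantsHypothesis.Theorems.ValuativeFlip

open scoped BigOperators Matrix
open Literature.NumberTheory.DiophantineGeometry Literature.Computability.AlgebraicComplexity

noncomputable section

/-- `1` is a highest-weight vector of weight `0` in any orbit-closure coordinate ring. [folklore] -/
theorem one_mem_highestWeightSpace_zero {σ : Type} [Fintype σ] [LinearOrder σ]
    (f : MvPolynomial σ ℂ) (m : ℕ) :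
    (1 : OrbitCoordRing f m) ∈ highestWeightSpace (orbitCoordRep f m) (0 : Weight σ) := by
  intro g _
  rw [orbitCoordRep_apply, map_one]
  simp [weightChar]

/-- **The semigroup floor** (the line's ENGINE, `stub_semigroupFloor` of the line card): in the
coordinate ring of the orbit closure of ANY form `f` of degree `m ≠ 0`, `D + 1` algebraically
independent highest-weight vectors of weight `χ` force `mult(k • χ) ≥ C(k + D, D)` for every `k`.
From `stub_gradedFloor` with `S a := HWV_{a • χ}` (multiplicative by `stub_hwvMul`, `add_nsmul`) and
the weight-pins-degree finiteness `finiteDimensional_highestWeightSpace_orbitCoordRep_holds`. -/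
theorem semigroupFloor {σ : Type} [Fintype σ] [LinearOrder σ] (f : MvPolynomial σ ℂ) {m : ℕ}
    (hm : m ≠ 0) (χ : Weight σ) (D : ℕ) (F : Fin (D + 1) → OrbitCoordRing f m)
    (hF : ∀ i, F i ∈ highestWeightSpace (orbitCoordRep f m) χ) (hind : AlgebraicIndependent ℂ F)
    (k : ℕ) : (k + D).choose D ≤ orbitMultiplicity ℂ f m (k • χ) := by
  set S : ℕ → Submodule ℂ (OrbitCoordRing f m) :=
    fun a => highestWeightSpace (orbitCoordRep f m) (a • χ) with hS
  have h1 : (1 : OrbitCoordRing f m) ∈ S 0 := by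
    simp only [hS, zero_nsmul]
    exact one_mem_highestWeightSpace_zero f m
  have hmul : ∀ a b : ℕ, S a * S b ≤ S (a + b) := by
    intro a b
    rw [Submodule.mul_le]
    intro x hx y hy
    have h := stub_hwvMul f m (a • χ) (b • χ) x y hx hy
    simp only [hS, add_nsmul]
    exact h
  have hF1 : ∀ i, F i ∈ S 1 := fun i => by
    simp only [hS, one_nsmul]
    exact hF i
  haveI : FiniteDimensional ℂ ↥(S k) :=
    finiteDimensional_highestWeightSpace_orbitCoordRep_holds (k := ℂ) f hm (k • χ)
  exact stub_gradedFloor S h1 hmul D F hF1 hind k inferInstance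


/-- `1 ∈ T_U(0, 0, 0)`: constants are homogeneous of degree `0`, lie in `P_U^0 = ⊤`, are fixed by
every substitution and have Borel weight `0`. [folklore] -/
theorem one_mem_trunc_zero (m : ℕ) (U : Submodule ℂ (MatIdx m → ℂ)) :
    (1 : MvPolynomial (MatIdx m × MatIdx m) ℂ) ∈
      MvPolynomial.homogeneousSubmodule (MatIdx m × MatIdx m) ℂ 0 ⊓
          ((MvPolynomial.vanishingIdeal ℂ
              {p : MatIdx m × MatIdx m → ℂ | ∀ j : MatIdx m, (fun i => p (j, i)) ∈ U}) ^ 0).restrictScalars ℂ ⊓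
          (⨅ (M : Matrix (MatIdx m) (MatIdx m) ℂ)
            (_ : linSubst (MatIdx m) ℂ M (detFormLex ℂ m) = detFormLex ℂ m),
            LinearMap.ker ((MvPolynomial.aeval fun p : MatIdx m × MatIdx m =>
                ∑ l : MatIdx m, M l p.2 •
                  (MvPolynomial.X (p.1, l) : MvPolynomial (MatIdx m × MatIdx m) ℂ)).toLinearMap -
              (LinearMap.id : MvPolynomial (MatIdx m × MatIdx m) ℂ →ₗ[ℂ] MvPolynomial (MatIdx m × MatIdx m) ℂ))) ⊓
          (⨅ (g : Matrix.GeneralLinearGroup (MatIdx m) ℂ) (_ : IsUpperTriangular g),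
            LinearMap.ker ((MvPolynomial.aeval fun p : MatIdx m × MatIdx m =>
                ∑ l : MatIdx m, ((g⁻¹ : Matrix.GeneralLinearGroup (MatIdx m) ℂ) :
                  Matrix (MatIdx m) (MatIdx m) ℂ) p.1 l •
                    (MvPolynomial.X (l, p.2) : MvPolynomial (MatIdx m × MatIdx m) ℂ)).toLinearMap -
              weightChar (0 : Weight (MatIdx m)) g •
                (LinearMap.id : MvPolynomial (MatIdx m × MatIdx m) ℂ →ₗ[ℂ] MvPolynomial (MatIdx m × MatIdx m) ℂ))) := by
  simp only [Submodule.mem_inf, Submodule.mem_iInf, LinearMap.mem_ker, LinearMap.sub_apply,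
    LinearMap.smul_apply, LinearMap.id_apply, AlgHom.toLinearMap_apply, map_one,
    Submodule.restrictScalars_mem, pow_zero, Ideal.one_eq_top, Submodule.mem_top, sub_self]
  refine ⟨⟨⟨(MvPolynomial.mem_homogeneousSubmodule 0 _).2 (MvPolynomial.isHomogeneous_one _ _),
    trivial⟩, fun _ _ => trivial⟩, fun g _ => ?_⟩
  have h0 : weightChar (0 : Weight (MatIdx m)) g = 1 := by simp [weightChar]
  rw [h0, one_smul, sub_self]

/-- **Matching floor** (line card §3.2): `D + 1` algebraically independent elements of the seed
truncation `T_U(Dg, t, ν)` give `dim T_U(k Dg, k t, k • ν) ≥ C(k + D, D)` for every `k`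
(`stub_gradedFloor` with `S a := T_U(a Dg, a t, a • ν)`, multiplicative by `stub_truncMul`;
`T_U(…) ≤ Hom_{k Dg}` is finite-dimensional).  `ℂ[End W]` being a polynomial ring, the det side
thus inherits every floor the engine certifies from any family it contains. -/
theorem matching_floor (m : ℕ) (U : Submodule ℂ (MatIdx m → ℂ)) (Dg t : ℕ) (ν : Weight (MatIdx m))
    (D : ℕ) (G : Fin (D + 1) → MvPolynomial (MatIdx m × MatIdx m) ℂ)
    (hG : ∀ i, G i ∈ MvPolynomial.homogeneousSubmodule (MatIdx m × MatIdx m) ℂ Dg ⊓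
          ((MvPolynomial.vanishingIdeal ℂ
              {p : MatIdx m × MatIdx m → ℂ | ∀ j : MatIdx m, (fun i => p (j, i)) ∈ U}) ^ t).restrictScalars ℂ ⊓
          (⨅ (M : Matrix (MatIdx m) (MatIdx m) ℂ)
            (_ : linSubst (MatIdx m) ℂ M (detFormLex ℂ m) = detFormLex ℂ m),
            LinearMap.ker ((MvPolynomial.aeval fun p : MatIdx m × MatIdx m =>
                ∑ l : MatIdx m, M l p.2 •
                  (MvPolynomial.X (p.1, l) : MvPolynomial (MatIdx m × MatIdx m) ℂ)).toLinearMap -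
              (LinearMap.id : MvPolynomial (MatIdx m × MatIdx m) ℂ →ₗ[ℂ] MvPolynomial (MatIdx m × MatIdx m) ℂ))) ⊓
          (⨅ (g : Matrix.GeneralLinearGroup (MatIdx m) ℂ) (_ : IsUpperTriangular g),
            LinearMap.ker ((MvPolynomial.aeval fun p : MatIdx m × MatIdx m =>
                ∑ l : MatIdx m, ((g⁻¹ : Matrix.GeneralLinearGroup (MatIdx m) ℂ) :
                  Matrix (MatIdx m) (MatIdx m) ℂ) p.1 l •
                    (MvPolynomial.X (l, p.2) : MvPolynomial (MatIdx m × MatIdx m) ℂ)).toLinearMap -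
              weightChar ν g •
                (LinearMap.id : MvPolynomial (MatIdx m × MatIdx m) ℂ →ₗ[ℂ] MvPolynomial (MatIdx m × MatIdx m) ℂ))))
    (hind : AlgebraicIndependent ℂ G) (k : ℕ) :
    (k + D).choose D ≤ Module.finrank ℂ ↥(MvPolynomial.homogeneousSubmodule (MatIdx m × MatIdx m) ℂ (k * Dg) ⊓
          ((MvPolynomial.vanishingIdeal ℂ
              {p : MatIdx m × MatIdx m → ℂ | ∀ j : MatIdx m, (fun i => p (j, i)) ∈ U}) ^ (k * t)).restrictScalars ℂ ⊓
          (⨅ (M : Matrix (MatIdx m) (MatIdx m) ℂ)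
            (_ : linSubst (MatIdx m) ℂ M (detFormLex ℂ m) = detFormLex ℂ m),
            LinearMap.ker ((MvPolynomial.aeval fun p : MatIdx m × MatIdx m =>
                ∑ l : MatIdx m, M l p.2 •
                  (MvPolynomial.X (p.1, l) : MvPolynomial (MatIdx m × MatIdx m) ℂ)).toLinearMap -
              (LinearMap.id : MvPolynomial (MatIdx m × MatIdx m) ℂ →ₗ[ℂ] MvPolynomial (MatIdx m × MatIdx m) ℂ))) ⊓
          (⨅ (g : Matrix.GeneralLinearGroup (MatIdx m) ℂ) (_ : IsUpperTriangular g),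
            LinearMap.ker ((MvPolynomial.aeval fun p : MatIdx m × MatIdx m =>
                ∑ l : MatIdx m, ((g⁻¹ : Matrix.GeneralLinearGroup (MatIdx m) ℂ) :
                  Matrix (MatIdx m) (MatIdx m) ℂ) p.1 l •
                    (MvPolynomial.X (l, p.2) : MvPolynomial (MatIdx m × MatIdx m) ℂ)).toLinearMap -
              weightChar (k • ν) g •
                (LinearMap.id : MvPolynomial (MatIdx m × MatIdx m) ℂ →ₗ[ℂ] MvPolynomial (MatIdx m × MatIdx m) ℂ)))) := by
  -- the filtration `a ↦ T_U(a Dg, a t, a • ν)`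
  set S : ℕ → Submodule ℂ (MvPolynomial (MatIdx m × MatIdx m) ℂ) := fun a =>
    MvPolynomial.homogeneousSubmodule (MatIdx m × MatIdx m) ℂ (a * Dg) ⊓
          ((MvPolynomial.vanishingIdeal ℂ
              {p : MatIdx m × MatIdx m → ℂ | ∀ j : MatIdx m, (fun i => p (j, i)) ∈ U}) ^ (a * t)).restrictScalars ℂ ⊓
          (⨅ (M : Matrix (MatIdx m) (MatIdx m) ℂ)
            (_ : linSubst (MatIdx m) ℂ M (detFormLex ℂ m) = detFormLex ℂ m),
            LinearMap.ker ((MvPolynomial.aeval fun p : MatIdx m × MatIdx m =>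
                ∑ l : MatIdx m, M l p.2 •
                  (MvPolynomial.X (p.1, l) : MvPolynomial (MatIdx m × MatIdx m) ℂ)).toLinearMap -
              (LinearMap.id : MvPolynomial (MatIdx m × MatIdx m) ℂ →ₗ[ℂ] MvPolynomial (MatIdx m × MatIdx m) ℂ))) ⊓
          (⨅ (g : Matrix.GeneralLinearGroup (MatIdx m) ℂ) (_ : IsUpperTriangular g),
            LinearMap.ker ((MvPolynomial.aeval fun p : MatIdx m × MatIdx m =>
                ∑ l : MatIdx m, ((g⁻¹ : Matrix.GeneralLinearGroup (MatIdx m) ℂ) :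
                  Matrix (MatIdx m) (MatIdx m) ℂ) p.1 l •
                    (MvPolynomial.X (l, p.2) : MvPolynomial (MatIdx m × MatIdx m) ℂ)).toLinearMap -
              weightChar (a • ν) g •
                (LinearMap.id : MvPolynomial (MatIdx m × MatIdx m) ℂ →ₗ[ℂ] MvPolynomial (MatIdx m × MatIdx m) ℂ)))
    with hS
  have h1 : (1 : MvPolynomial (MatIdx m × MatIdx m) ℂ) ∈ S 0 := by
    have h := one_mem_trunc_zero m U
    simp only [hS, zero_mul, zero_nsmul]
    exact h
  have hmul : ∀ a b : ℕ, S a * S b ≤ S (a + b) := by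
    intro a b
    rw [Submodule.mul_le]
    intro x hx y hy
    have h := stub_truncMul m U (a * Dg) (b * Dg) (a * t) (b * t) (a • ν) (b • ν) x y hx hy
    simp only [hS, add_mul, add_nsmul]
    exact h
  have hG1 : ∀ i, G i ∈ S 1 := fun i => by
    simp only [hS, one_mul, one_nsmul]
    exact hG i
  haveI hfin : FiniteDimensional ℂ ↥(S k) := by
    refine Submodule.finiteDimensional_of_le (?_ : S k ≤
      (MvPolynomial.restrictTotalDegree (MatIdx m × MatIdx m) ℂ (k * Dg)))
    intro x hx
    have hx' : x ∈ MvPolynomial.homogeneousSubmodule (MatIdx m × MatIdx m) ℂ (k * Dg) := hx.1.1.1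
    rw [MvPolynomial.mem_restrictTotalDegree]
    rw [MvPolynomial.mem_homogeneousSubmodule] at hx'
    exact hx'.totalDegree_le
  exact stub_gradedFloor S h1 hmul D G hG1 hind k hfin

/-- **Formal matching — the kill** (line card §3, `deficit_of_census`): a det census
`dim T_U(k Dg, k t, k • ν) < C(k + D, D)` at ANY admissible centre forces EVERY `D + 1` elements of the
seed truncation `T_U(Dg, t, ν)` to be algebraically DEPENDENT in the polynomial ring `ℂ[End W]`.
Since `T_U(mδ₀, δ₀(m - r), ν)` contains the pulled-back Kadish–Landsberg lifts of the per seeds for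
every admissible `(U, r)` (the `ValuativeBound` mechanism: `OrbitMapKernel`, `CoeffVanishingOrder`,
both proved), `stub_detCensus` can only hold where those covariants satisfy a relation on
`End(W_m) · det_m` that fails on `Δ_m(X₀₀^{m-n} per_n)` — already a separating equation, with the
engine idle (line card §3(a)). -/
theorem census_forces_dependence (m : ℕ) (U : Submodule ℂ (MatIdx m → ℂ)) (Dg t : ℕ)
    (ν : Weight (MatIdx m)) (D : ℕ) (G : Fin (D + 1) → MvPolynomial (MatIdx m × MatIdx m) ℂ)
    (hG : ∀ i, G i ∈ MvPolynomial.homogeneousSubmodule (MatIdx m × MatIdx m) ℂ Dg ⊓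
          ((MvPolynomial.vanishingIdeal ℂ
              {p : MatIdx m × MatIdx m → ℂ | ∀ j : MatIdx m, (fun i => p (j, i)) ∈ U}) ^ t).restrictScalars ℂ ⊓
          (⨅ (M : Matrix (MatIdx m) (MatIdx m) ℂ)
            (_ : linSubst (MatIdx m) ℂ M (detFormLex ℂ m) = detFormLex ℂ m),
            LinearMap.ker ((MvPolynomial.aeval fun p : MatIdx m × MatIdx m =>
                ∑ l : MatIdx m, M l p.2 •
                  (MvPolynomial.X (p.1, l) : MvPolynomial (MatIdx m × MatIdx m) ℂ)).toLinearMap -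
              (LinearMap.id : MvPolynomial (MatIdx m × MatIdx m) ℂ →ₗ[ℂ] MvPolynomial (MatIdx m × MatIdx m) ℂ))) ⊓
          (⨅ (g : Matrix.GeneralLinearGroup (MatIdx m) ℂ) (_ : IsUpperTriangular g),
            LinearMap.ker ((MvPolynomial.aeval fun p : MatIdx m × MatIdx m =>
                ∑ l : MatIdx m, ((g⁻¹ : Matrix.GeneralLinearGroup (MatIdx m) ℂ) :
                  Matrix (MatIdx m) (MatIdx m) ℂ) p.1 l •
                    (MvPolynomial.X (l, p.2) : MvPolynomial (MatIdx m × MatIdx m) ℂ)).toLinearMap -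
              weightChar ν g •
                (LinearMap.id : MvPolynomial (MatIdx m × MatIdx m) ℂ →ₗ[ℂ] MvPolynomial (MatIdx m × MatIdx m) ℂ))))
    (k : ℕ)
    (hcensus : Module.finrank ℂ ↥(MvPolynomial.homogeneousSubmodule (MatIdx m × MatIdx m) ℂ (k * Dg) ⊓
          ((MvPolynomial.vanishingIdeal ℂ
              {p : MatIdx m × MatIdx m → ℂ | ∀ j : MatIdx m, (fun i => p (j, i)) ∈ U}) ^ (k * t)).restrictScalars ℂ ⊓
          (⨅ (M : Matrix (MatIdx m) (MatIdx m) ℂ)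
            (_ : linSubst (MatIdx m) ℂ M (detFormLex ℂ m) = detFormLex ℂ m),
            LinearMap.ker ((MvPolynomial.aeval fun p : MatIdx m × MatIdx m =>
                ∑ l : MatIdx m, M l p.2 •
                  (MvPolynomial.X (p.1, l) : MvPolynomial (MatIdx m × MatIdx m) ℂ)).toLinearMap -
              (LinearMap.id : MvPolynomial (MatIdx m × MatIdx m) ℂ →ₗ[ℂ] MvPolynomial (MatIdx m × MatIdx m) ℂ))) ⊓
          (⨅ (g : Matrix.GeneralLinearGroup (MatIdx m) ℂ) (_ : IsUpperTriangular g),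
            LinearMap.ker ((MvPolynomial.aeval fun p : MatIdx m × MatIdx m =>
                ∑ l : MatIdx m, ((g⁻¹ : Matrix.GeneralLinearGroup (MatIdx m) ℂ) :
                  Matrix (MatIdx m) (MatIdx m) ℂ) p.1 l •
                    (MvPolynomial.X (l, p.2) : MvPolynomial (MatIdx m × MatIdx m) ℂ)).toLinearMap -
              weightChar (k • ν) g •
                (LinearMap.id : MvPolynomial (MatIdx m × MatIdx m) ℂ →ₗ[ℂ] MvPolynomial (MatIdx m × MatIdx m) ℂ)))) <
        (k + D).choose D) :
    ¬ AlgebraicIndependent ℂ G := fun hind =>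
  absurd (matching_floor m U Dg t ν D G hG hind k) (not_le.2 hcensus)

end

end Summit.ValiantsHypothesis.ValiantsHypothesis.Theorems.ValuativeFlip
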